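import Summits.AnomalousDissipation.AnomalousDissipation.Theses.SawtoothPulseCascade
import Summits.AnomalousDissipation.AnomalousDissipation.Theorems.SawtoothPulseCascadeApproxLipEnvelopeBox
import Summits.AnomalousDissipation.AnomalousDissipation.Theorems.SawtoothPulseCascadeK3LocalisedClosureApproxBookkeeping
import Summits.AnomalousDissipation.AnomalousDissipation.Theorems.SawtoothPulseCascadeK3LocalisedClosureApproxResponse

/-!
# ApproxSol58 from K2″ and the per-phase Lipschitz cap — the conditional closer of the line `linear-response-lip`
(route `AnomalousDissipation/SawtoothPulseCascade`; helper for the crux ApproxSol58 = stmt-AnomalousDissipation-19688)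

The lead's census of ApproxSol58 (evidence `CENSUS-ApproxSol58-g3.md` on the item) found the registered load-bearing stub
`stub_responseStrainDefect` under-hypothesised: `K2″` (`K2PhaseGrowthClassical`, an `L² → L²` cap) does not control
the Lipschitz size of the linearised response, which the nonlinear closure needs.  The reshaped skeleton
`linear-response-lip` (evidence `ApproxSol58_linearResponseLip_v21.lean`) makes the missing input an explicit hypothesis,
the per-phase LIPSCHITZ cap `K2LipschitzGrowthClassical` (Literature `SawtoothCascadeK2Lipschitz.lean`) with some factor
`G < (γ² − 3)²` at each box point, and splits the rest into S1 (`L²` envelope from K2″ — LANDED as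
`ApproxResponse.responseL2Envelope`, p487819), S2 (Lipschitz envelope from the cap — LANDED as
`ApproxResponse.responseLipEnvelope`, `…ApproxLipEnvelopeBox`), S3 (envelope bookkeeping — LANDED as
`DriftFreeApprox.envelopeBookkeeping`, p478671) and the composition through the landed interface
`DriftFreeApprox.approximateSolution_of_envelopes` (p473374) + `exists_linearisedResponse` (p475670).

This file is that composition, kernel-checked:

* `approximateSolution_of_lipschitzCap` — at a box point, K2″ there and the Lipschitz cap there (factor
  `0 ≤ G < (γ²−3)²`) give `DriftFree.ApproximateSolution ⟨γ,1/4,2,1,ρN⟩ (γ²−3)`;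
* `approxSol58_of_lipschitzCap` — the crux `ApproxSol58` BY NAME, CONDITIONAL on the Lipschitz cap over the box
  (the hypothesis is the body of the lead's `K2LipschitzCascadeGrowth58`, the proposed new crux K2Lip; it is an open
  conjecture and is not asserted anywhere in the tree);
* downstream (sequel `…TargetOfLipschitzCap`): with the landed closers of `Packaging58` / `DriftFreeClosure58` /
  `K3LocalisedClosureGlue`, the rung `Target` of the route follows from `K1LocalisedCascade`,
  `K2LinearisedCascadeGrowth` and the Lipschitz cap over the box.

Numerics of record for the cap (eng TEST E lineage A/B, K2Lip falsifier j263373): per-phase Lipschitz factors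
`21.6/27.5` at `(5,2)` (room `484`), `143 = 0.296·r²` at `(5,7)` phase 2, `295` at `(8,7)` (room `3721`).
-/

set_option linter.dupNamespace false

noncomputable section

namespace Summit.AnomalousDissipation.AnomalousDissipation.Theorems.SawtoothPulseCascade.ApproxResponse

open Set MeasureTheory
open scoped ContDiff InnerProductSpace
open Literature.Analysis Literature.Analysis.FunctionSpaces Literature.Analysis.FluidPDE
open Literature.Analysis.FluidPDE.SawtoothCascade
open Literature.Analysis.FluidPDE.SawtoothCascade.CascadeParams
/-- **`ApproximateSolution` at a box point from K2″ and the Lipschitz cap there.**  For `(γ, ρN) ∈ [5,8] × {2,…,7}`,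
`K2PhaseGrowthClassical ⟨γ,1/4,2,1,ρN⟩ 3` and `K2LipschitzGrowthClassical ⟨γ,1/4,2,1,ρN⟩ G` with `0 ≤ G < (γ²−3)²`
give the Grenier approximate solution `DriftFree.ApproximateSolution ⟨γ,1/4,2,1,ρN⟩ (γ²−3)`: the classical forced
linearised response on `[0, (T+1)/2]` (p475670) with its `L²` envelope (p487819) and its continuous Lipschitz envelope
(`responseLipEnvelope`), the envelope bookkeeping (p478671), and the interface `approximateSolution_of_envelopes`
(p473374). -/
theorem approximateSolution_of_lipschitzCap {γ : ℝ} (hγ : γ ∈ Icc (5 : ℝ) 8) {ρN : ℕ} (hρN : ρN ∈ Finset.Icc 2 7)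
    (hK2 : K2PhaseGrowthClassical ⟨γ, 1 / 4, 2, 1, ρN⟩ 3) {G : ℝ} (hG0 : 0 ≤ G) (hGlt : G < (γ ^ 2 - 3) ^ 2)
    (hLip : K2LipschitzGrowthClassical ⟨γ, 1 / 4, 2, 1, ρN⟩ G) :
    DriftFree.ApproximateSolution ⟨γ, 1 / 4, 2, 1, ρN⟩ (γ ^ 2 - 3) := by
  have hγ0 : (0 : ℝ) ≤ γ := le_trans (by norm_num) hγ.1
  obtain ⟨M₂, K₂, hM₂0, hM₂, hK₂0, H1⟩ := responseL2Envelope hγ hρN hK2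
  obtain ⟨M₁, K₁, hM₁0, hM₁, hK₁0, H2⟩ := responseLipEnvelope hγ hρN hG0 hGlt hLip
  refine DriftFreeApprox.approximateSolution_of_envelopes ⟨γ, 1 / 4, 2, 1, ρN⟩ hγ0 (by norm_num) (by norm_num) ?_
  intro A ε hε
  obtain ⟨ν₁, hν₁, H1A⟩ := H1 A
  obtain ⟨ν₂, hν₂, H2A⟩ := H2 A
  obtain ⟨ν₃, hν₃, H3A⟩ := DriftFreeApprox.envelopeBookkeeping γ hγ ρN hρN M₁ M₂ K₁ K₂ hM₁0 hM₁ hM₂0 hM₂ hK₁0 hK₂0 A ε hε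
  refine ⟨min ν₁ (min ν₂ ν₃), lt_min hν₁ (lt_min hν₂ hν₃), fun ν hν => ?_⟩
  have hn1 : ν ∈ Ioc 0 ν₁ := ⟨hν.1, hν.2.trans (min_le_left _ _)⟩
  have hn2 : ν ∈ Ioc 0 ν₂ := ⟨hν.1, (hν.2.trans (min_le_right _ _)).trans (min_le_left _ _)⟩
  have hn3 : ν ∈ Ioc 0 ν₃ := ⟨hν.1, (hν.2.trans (min_le_right _ _)).trans (min_le_right _ _)⟩
  set T := DriftFree.horizon (γ ^ 2 - 3) ν A with hT
  have hT0 : 0 ≤ T := CascadeParams.tStart_nonneg _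
  have hT1 : T < 1 := CascadeParams.tStart_lt_one _
  -- the window end `T' = (T + 1)/2` and the response on `[0, T']`
  set T' : ℝ := (T + 1) / 2 with hT'
  have hTT' : T < T' := by rw [hT']; linarith
  have hT'1 : T' < 1 := by rw [hT']; linarith
  have hT'0 : 0 < T' := hT0.trans_lt hTT'
  obtain ⟨L, q, hL, hq, hdiv, hL0, hlin⟩ :=
    DriftFreeApprox.exists_linearisedResponse ⟨γ, 1 / 4, 2, 1, ρN⟩ (by norm_num) (by norm_num) hν.1 hT'0 hT'1
  -- the envelopes
  obtain ⟨Λ, hΛc, hΛ, hΛle⟩ := H2A ν hn2 T' hTT' hT'1 L q hL hq hdiv hL0 hlin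
  have hEle := H1A ν hn1 T' hTT' hT'1 L q hL hq hdiv hL0 hlin
  set E : ℝ → ℝ := fun t => Real.sqrt (FluidPDE.Torus.vectorL2Sq (L t)) with hE
  have hEc : ContinuousOn E (Icc 0 T) := by
    have h := (hL.continuousOn_integral_norm_sq (convex_Icc 0 T')).mono (Icc_subset_Icc le_rfl hTT'.le)
    exact (Real.continuous_sqrt.comp_continuousOn h).congr fun s _ => rfl
  have henv : ∀ j : ℕ, ∀ t ∈ Icc 0 T, t ∈ Icc (CascadeParams.tStart j) (CascadeParams.tStart (j + 1)) →
      0 ≤ E t ∧ E t ≤ K₂ * ν * ((j : ℝ) + 1) * M₂ ^ (j + 1) ∧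
      0 ≤ Λ t ∧ Λ t ≤ K₁ * ν * ((j : ℝ) + 1) * M₁ ^ (j + 1) :=
    fun j t ht hj => ⟨Real.sqrt_nonneg _, hEle j t ht hj, (norm_nonneg _).trans (hΛ t ht 0), hΛle j t ht hj⟩
  obtain ⟨hint, hdef⟩ := H3A ν hn3 E Λ hEc hΛc henv
  exact ⟨T', hTT', hT'1, L, q, E, Λ, hL, hq, hdiv, hL0, hlin, fun t _ => le_rfl, hΛ, hEc, hΛc, hint, hdef⟩

/-- **The crux `ApproxSol58` BY NAME, conditional on the per-phase Lipschitz cap over the box** (the body of the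
lead's proposed crux `K2LipschitzCascadeGrowth58`: at every `(γ, ρN) ∈ [5,8] × {2,…,7}` a Lipschitz cap with SOME
factor `0 ≤ G < (γ² − 3)²`).  `ApproxSol58 = K2LinearisedCascadeGrowth → ∀ box, ApproximateSolution …`; K2″ is taken
on `[4,8] ⊇ [5,8]`. -/
theorem approxSol58_of_lipschitzCap
    (hLip58 : ∀ γ ∈ Set.Icc (5 : ℝ) 8, ∀ ρN ∈ Finset.Icc 2 7, ∃ G : ℝ, 0 ≤ G ∧ G < (γ ^ 2 - 3) ^ 2 ∧
      K2LipschitzGrowthClassical ⟨γ, 1 / 4, 2, 1, ρN⟩ G) :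
    Summit.AnomalousDissipation.AnomalousDissipation.Theses.SawtoothPulseCascade.ApproxSol58 := by
  intro hK2 γ hγ ρN hρN
  obtain ⟨G, hG0, hGlt, hLip⟩ := hLip58 γ hγ ρN hρN
  have hγ' : γ ∈ Set.Icc (4 : ℝ) 8 := ⟨by linarith [hγ.1], hγ.2⟩
  exact approximateSolution_of_lipschitzCap hγ hρN (hK2 γ hγ' ρN hρN) hG0 hGlt hLip

end Summit.AnomalousDissipation.AnomalousDissipation.Theorems.SawtoothPulseCascade.ApproxResponse

end
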